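import Summits.BirchSwinnertonDyer.BirchSwinnertonDyer.Theses.CumulativeHeegnerLeopoldt
import Summits.BirchSwinnertonDyer.BirchSwinnertonDyer.Theorems.CumulativeHeegnerLeopoldtWAllExclAddWildRankOneOfResidualContent
import HarnessLib

/-!
# Route `CumulativeHeegnerLeopoldt` (rev 5) — the gate glue of the split of crux K1
# `CumulativeHeegnerInclusionAtThree` (stmt-BirchSwinnertonDyer-24198): A → P → B1P → K1, PROVED

Lead prover bsd-line-chl-k1-p1 g2 (`--workitem stmt-BirchSwinnertonDyer-26899`). The pen (bsd-wall-pss3 g18,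
CHL rev 5 commit 7d9be2b91aac) split K1 into the research crux A `TemperedHeegnerInclusionAtThree` (26896 =
stub A of line `birth` verbatim), the print input P `ResidualSelmerPrintedInputAtThree` (26897 := the Literature
named fact `CastellaGrossiLeeSkinner2022.prop14_residualCharacterSelmer_finite`) and B1P
`ResidualSelmerFiniteAtThreeOfPrint` (26898 := P → stub B1 verbatim), with the glue item 26899
`CumulativeHeegnerInclusionAtThreeGlue := A → P → B1P → K1`. This file closes the GLUE by the composition of
line `birth` (A gives the tempered inclusion span(3^μ L) ⊆ Ch, B1 gives μ_alg = 0 i.e. Ch·R₀⟦T⟧ = (g) with a unit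
coefficient, saturation removes 3^μ), packaged by -w2's
`CumulativeHeegnerLeopoldtResidualContent.cumulativeHeegnerInclusionAtThree_of_temperedInclusion_of_residualSelmerFinite`
(p611195). A one-line kernel composition; A and P stay displayed antecedents; BSD is not proved by any of this.
-/

-- `…BirchSwinnertonDyer.BirchSwinnertonDyer.Theorems…` is the problem's mandated namespace (D-0017).
set_option linter.dupNamespace false

namespace Summit.BirchSwinnertonDyer.BirchSwinnertonDyer.Theorems

/-- **The glue of the K1 split, PROVED**: `TemperedHeegnerInclusionAtThree → ResidualSelmerPrintedInputAtThree →
ResidualSelmerFiniteAtThreeOfPrint → CumulativeHeegnerInclusionAtThree` — from A, P and B1P one gets A and B1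
(= B1P P), and line `birth`'s composition A ∧ B1 ⟹ K1
(`…ResidualContent.cumulativeHeegnerInclusionAtThree_of_temperedInclusion_of_residualSelmerFinite`: μ-half via UTD's
Greenberg criterion, saturation via `stub_threeSaturation`). [cite: CastellaGrossiLeeSkinner2022, §1 Props. 14, 17, 18 (arXiv:2008.02571)] -/
theorem cumulativeHeegnerLeopoldt_cumulativeHeegnerInclusionAtThreeGlue_proof :
    Summit.BirchSwinnertonDyer.BirchSwinnertonDyer.Theses.CumulativeHeegnerLeopoldt.CumulativeHeegnerInclusionAtThreeGlue :=
  fun hA hP hB ↦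
    CumulativeHeegnerLeopoldtResidualContent.cumulativeHeegnerInclusionAtThree_of_temperedInclusion_of_residualSelmerFinite
      hA (hB hP)

end Summit.BirchSwinnertonDyer.BirchSwinnertonDyer.Theorems
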